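import Mathlib
import HarnessLib
import Summits.ValiantsHypothesis.ValiantsHypothesis.Theorems.MonotoneRestorationQP.Negative.LoadBearing
import Summits.ValiantsHypothesis.ValiantsHypothesis.Theorems.MonotoneRestorationMonotoneRestorationQPPermSupportCount

/-!
# Theorem γ, step G5: the arithmetic of the support-accumulation corollary
(crux `stmt-ValiantsHypothesis-15886`, line `Sketch`, registered stub `stub_gammaArithmetic`)

Helper file (`--supports stmt-ValiantsHypothesis-15886`) of line `Sketch` of the crux
`Summit.ValiantsHypothesis.ValiantsHypothesis.Theses.MonotoneRestoration.MonotoneRestorationQP`.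
Theorem γ of the line bounds cancellation-free square-symmetric circuits for a row-multilinear
homogeneous polynomial of degree `d` on the `n × n` matrix from below by `C(n, k)` whenever
`2 ≤ k`, `k² ≤ d`, `d + k + 9 ≤ n`, `4 k ≤ n`, `n > 8`.  Its corollary is applied with
`d = n / 2` and `k = (log₂ n + c) ^ c + 2` against circuits of size
`≤ 2 ^ ((log₂ n + c) ^ c)`; this file supplies, for every `c` and all large `n`, the four side
conditions together with the final inequality `2 ^ ((log₂ n + c) ^ c) < C(n, k)`.

Proof: with `L := Nat.log 2 n`, `M := (L + c) ^ c`, `k := M + 2` and `a := L + (2 c + 2) ≥ 2` one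
has `k ≤ 3 a ^ c`, hence
`8 k² ≤ 72 a ^ (2 c) ≤ 18 a ^ (2 c + 2) = 18 (L + (2 c + 2)) ^ (2 c + 2)`, and the tree's
`polylog_pow_lt_linear (2 c + 2)` with `δ := 1 / 18` makes this `< n` for all large `n`.  From
`8 k² < n` (and `k ≥ 2`) the four linear/quadratic side conditions are immediate, and
`2 ^ M < 2 ^ (M + 2) ≤ C(n, M + 2)` by the tree's `permSupportCount_two_pow_le_choose`
(`2 (M + 2) ≤ n`).
-/

-- `ValiantsHypothesis.ValiantsHypothesis`: the D-0017 layout repeats the problem name in the path.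
set_option linter.dupNamespace false

namespace Summit.ValiantsHypothesis.ValiantsHypothesis.Theorems

/-- The polynomial comparison: if `m ≤ a ^ c` and `2 ≤ a` then
`8 (m + 2)² ≤ 18 a ^ (2 c + 2)`. [folklore] -/
theorem gammaArithmetic_eight_mul_sq_le {m a c : ℕ} (hm : m ≤ a ^ c) (ha : 2 ≤ a) :
    8 * ((m + 2) * (m + 2)) ≤ 18 * a ^ (2 * c + 2) := by
  have h1 : 1 ≤ a ^ c := Nat.one_le_pow c a (by omega)
  have h3 : m + 2 ≤ 3 * a ^ c := by omega
  have h4 : (m + 2) * (m + 2) ≤ (3 * a ^ c) * (3 * a ^ c) := Nat.mul_le_mul h3 h3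
  have h5 : 4 ≤ a * a := Nat.mul_le_mul ha ha
  calc 8 * ((m + 2) * (m + 2)) ≤ 8 * ((3 * a ^ c) * (3 * a ^ c)) := Nat.mul_le_mul_left 8 h4
    _ = a ^ c * a ^ c * 72 := by ring
    _ ≤ a ^ c * a ^ c * (18 * (a * a)) := Nat.mul_le_mul_left _ (by omega)
    _ = 18 * a ^ (2 * c + 2) := by ring

/-- The tree's `polylog_pow_lt_linear` in natural-number form: `18 (log₂ n + c) ^ c < n` for all
large `n`. [folklore] -/
theorem gammaArithmetic_eighteen_mul_lt (c : ℕ) :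
    ∃ N : ℕ, ∀ n : ℕ, N ≤ n → 18 * (Nat.log 2 n + c) ^ c < n := by
  obtain ⟨n₀, h⟩ :=
    MonotoneRestorationQP.Negative.polylog_pow_lt_linear c (δ := 1 / 18) (by norm_num)
  refine ⟨n₀, fun n hn => ?_⟩
  have h1 := h n hn
  have h2 : ((18 * (Nat.log 2 n + c) ^ c : ℕ) : ℝ) < n := by
    push_cast
    linarith
  exact_mod_cast h2

/-- **G5 — the arithmetic of Theorem γ's corollary.** For every `c` and all large `n`, with
`k := (log₂ n + c) ^ c + 2`: `8 < n`, `4 k ≤ n`, `k · k ≤ n / 2`, `n / 2 + k + 9 ≤ n`, and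
`2 ^ ((log₂ n + c) ^ c) < C(n, k)`. [folklore] -/
theorem stub_gammaArithmetic (c : ℕ) : ∃ N : ℕ, ∀ n : ℕ, N ≤ n →
    8 < n ∧
    4 * ((Nat.log 2 n + c) ^ c + 2) ≤ n ∧
    ((Nat.log 2 n + c) ^ c + 2) * ((Nat.log 2 n + c) ^ c + 2) ≤ n / 2 ∧
    n / 2 + ((Nat.log 2 n + c) ^ c + 2) + 9 ≤ n ∧
    2 ^ ((Nat.log 2 n + c) ^ c) < n.choose ((Nat.log 2 n + c) ^ c + 2) := by
  obtain ⟨N, hN⟩ := gammaArithmetic_eighteen_mul_lt (2 * c + 2)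
  refine ⟨N, fun n hn => ?_⟩
  have hlt : 8 * (((Nat.log 2 n + c) ^ c + 2) * ((Nat.log 2 n + c) ^ c + 2)) < n :=
    lt_of_le_of_lt
      (gammaArithmetic_eight_mul_sq_le (Nat.pow_le_pow_left (by omega) c) (by omega)) (hN n hn)
  generalize (Nat.log 2 n + c) ^ c = M at hlt ⊢
  have hk : M + 2 ≤ (M + 2) * (M + 2) := Nat.le_mul_self _
  have h4 : 2 * 2 ≤ (M + 2) * (M + 2) :=
    Nat.mul_le_mul (by omega : 2 ≤ M + 2) (by omega : 2 ≤ M + 2)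
  refine ⟨by omega, by omega, by omega, by omega, ?_⟩
  calc 2 ^ M < 2 ^ (M + 2) := Nat.pow_lt_pow_right (by norm_num) (by omega)
    _ ≤ n.choose (M + 2) := permSupportCount_two_pow_le_choose (M + 2) n (by omega)

end Summit.ValiantsHypothesis.ValiantsHypothesis.Theorems
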